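import Summits.HodgeConjecture.HodgeConjecture.Theses.TropicalKugaSatakeCayley

/-!
# Birth skeleton (BC3) — crux `FormalCycleCriterion` of route `TropicalKugaSatakeCayley`

Crux item `stmt-HodgeConjecture-18571`, decl
`Summit.HodgeConjecture.HodgeConjecture.Theses.TropicalKugaSatakeCayley.FormalCycleCriterion` (K3,
Kontsevich's "formal cycles"): if `t ∈ ksPosCone` has `ℚ`-linearly independent coordinates and `Z` is
an effective framed simplicial tropical `2`-cycle of `ℝ⁸ / B_t ℤ⁸` (`B_t = ksMatrix t`), then on some
non-empty open `U ⊆ ksPosCone` every `B_{t'}`, `t' ∈ U`, carries an effective tropical `2`-cycle with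
the SAME period class `compound 2 B_{t'}⁻¹ · classOf`.

## The seam (the route header's TWO-LAYER PLAN `K3 ⇐ LinearFamily → ClassesTotallyDisconnected → K3`, typed)

* `stub_formalFamily` — THE FORMAL CYCLE (size L; Zharkov p. 3 "cycles which vary rationally over
  the space of parameters", Kontsevich): at a `ℚ`-generic `t`, the effective cycle `Z` is the member
  `t' = t` of a family of framed chains `⟨Z.size, cell t'⟩` over an open preconnected `U ∋ t`,
  `U ⊆ ksPosCone`, with the SAME direction frames and weights, in which every incidence of `Z` at `t`
  (two ordered faces being `B_t ℤ⁸`-translates) persists as the corresponding incidence at `t'`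
  (w.r.t. `B_{t'} ℤ⁸`), every member is effective, and the period class moves continuously.
  Mechanism: the incidences are a homogeneous `ℚ`-LINEAR system `L(x) = N(t')` in the vertex data
  `x = (base, coef)` (`dir` rational, `B_{t'} k` linear in `t'` with integer coefficients); its
  solvability locus `N⁻¹(range L)` is a rational subspace of `ℝ⁵` containing the `ℚ`-generic `t`,
  hence all of `ℝ⁵`; an affine section through `x_Z` gives the family, effectivity (`w · det coef > 0`)
  and positive-definiteness are open, the class is polynomial in `coef` times `compound 2 B_{t'}⁻¹`.
* `stub_isCycle_of_incidences` — INCIDENCE COARSENING KEEPS `IsCycle` (size M; the "zero-sum face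
  groups merge" clause of the crux's why-it-might-fail, isolated as a combinatorial lemma): if two
  families of cells have the same framings and every `Per`-incidence among the ordered faces of the
  first is a `Per'`-incidence among the corresponding faces of the second, then `IsCycle Per` for the
  first implies `IsCycle Per'` for the second (`IsTranslate Per` is an equivalence relation; the
  `Per'`-classes of face indices are unions of `Per`-classes, each of which sums to zero).
* `stub_cycleClassRational` — PERIOD CLASSES OF CYCLES ARE RATIONAL (size L; "homology invariance of
  the tautological class for the chain encoding", the crux's first named risk): for `P ≻ 0` and every
  framed chain `Z` with `Z.IsCycle P`, `compound 2 P⁻¹ · Z.classOf` has rational entries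
  (`classOf = Σ_σ ∫_σ dx_K ⊗ framing_σ`; the alternating boundary of `Z` vanishes modulo `P ℤ⁸`, so the
  barycentric subdivision of `Z` is a singular `2`-cycle of the torus with coefficients in `⋀² ℚ⁸`, whose
  `dx_K`-periods lie in `⋀²(P ℤ⁸) ⊗ ℚ = compound 2 P · ℚ`-matrices; Cauchy–Binet).
  [MikhalkinZharkov2014Eigenwave Prop. 4.3, Thm. 5.4; Zharkov2020TropicalWeil p. 2]

`FormalCycleCriterion_of` is the real (sorry-free) composition: stub 1 gives `U` and the family;
stub 2 makes every member a cycle for its own lattice; stub 3 makes the period class rational-valued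
along the family; a continuous rational-valued function on a preconnected set is constant
(`apply_eq_of_ratValued`: intermediate value theorem + an irrational number between two distinct
reals), so every member has the class of `Z`.

No stub alone gives the crux (stub 1 has no cycle condition off `t` and no constancy of the class;
stub 2 is a combinatorial statement about two fixed chains; stub 3 concerns one torus) nor
`HodgeConjecture` / `¬ HodgeConjecture`; the BC3 probes (`stub → FormalCycleCriterion`,
`stub → HodgeConjecture`, `stub → ¬ HodgeConjecture` by `first | exact? | simpa [·] | (unfold ·; simpa) | aesop`)
are run in the registering seat's sibling probe file `bc/FormalCycleCriterion_probes.lean` and all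
fail (see that seat's NOTES.md). Disproof used: none (no `Disproof.lean` on this crux). Dead lines: none.
-/

namespace Summit.HodgeConjecture.HodgeConjecture.Cruxes.FormalCycleCriterion.Birth

open Summit.HodgeConjecture.HodgeConjecture.Theses.TropicalKugaSatakeCayley
open Literature.AlgebraicGeometry.Tropical

noncomputable section

/-- **Stub 1 — the formal cycle through `Z` (Kontsevich).** At a parameter `t ∈ ksPosCone` with
`ℚ`-linearly independent coordinates, an effective tropical `2`-cycle `Z` of `ℝ⁸ / B_t ℤ⁸` is the
member `t' = t` of a family of framed chains with the same number of cells, direction frames and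
weights, over an open preconnected `U ∋ t` inside the cone, along which every `B_t`-incidence of
ordered faces of `Z` persists as a `B_{t'}`-incidence, every member is effective, and the period
class `compound 2 B_{t'}⁻¹ · classOf` is continuous. [cite: Zharkov2020TropicalWeil, p. 3]
[cite: MikhalkinZharkov2014Eigenwave, Def. 4.2] -/
theorem stub_formalFamily :
    ∀ t : Fin 5 → ℝ, t ∈ ksPosCone → LinearIndependent ℚ t →
      ∀ Z : TropicalTorus.Chain ℝ 8 2, Z.IsCycle (ksMatrix t) → Z.Effective →
        ∃ U : Set (Fin 5 → ℝ), IsOpen U ∧ IsPreconnected U ∧ t ∈ U ∧ U ⊆ ksPosCone ∧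
          ∃ cell : (Fin 5 → ℝ) → Fin Z.size → TropicalTorus.Cell ℝ 8 2,
            cell t = Z.cell ∧
            (∀ t' c, (cell t' c).dir = (Z.cell c).dir ∧ (cell t' c).weight = (Z.cell c).weight) ∧
            (∀ t' ∈ U, ∀ (c c' : Fin Z.size) (i i' : Fin 3) (π π' : Equiv.Perm (Fin 2)),
              TropicalTorus.IsTranslate (ksMatrix t) ((Z.cell c).face i ∘ π) ((Z.cell c').face i' ∘ π') →
                TropicalTorus.IsTranslate (ksMatrix t') ((cell t' c).face i ∘ π) ((cell t' c').face i' ∘ π')) ∧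
            (∀ t' ∈ U, (⟨Z.size, cell t'⟩ : TropicalTorus.Chain ℝ 8 2).Effective) ∧
            ContinuousOn (fun t' => TropicalTorus.compound 2 (ksMatrix t')⁻¹ *
              (⟨Z.size, cell t'⟩ : TropicalTorus.Chain ℝ 8 2).classOf) U := by
  sorry

/-- **Stub 2 — coarsening the incidences keeps the cycle condition.** Two families of `n` framed
`2`-cells of `ℝ⁸` with the same framings: if every incidence "ordered face `(c, i, π)` is a
`Per ℤ⁸`-translate of ordered face `(c', i', π')`" of the first family holds for the corresponding
faces of the second w.r.t. `Per'`, then the first chain being a cycle of `ℝ⁸ / Per ℤ⁸` makes the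
second a cycle of `ℝ⁸ / Per' ℤ⁸` (translate-classes of face indices only merge, and each old class
has zero signed framing sum). [cite: Zharkov2020TropicalWeil, p. 2] -/
theorem stub_isCycle_of_incidences :
    ∀ (n : ℕ) (cell cell' : Fin n → TropicalTorus.Cell ℝ 8 2) (Per Per' : Matrix (Fin 8) (Fin 8) ℝ),
      (∀ c, (cell' c).framing = (cell c).framing) →
      (∀ (c c' : Fin n) (i i' : Fin 3) (π π' : Equiv.Perm (Fin 2)),
        TropicalTorus.IsTranslate Per ((cell c).face i ∘ π) ((cell c').face i' ∘ π') →
          TropicalTorus.IsTranslate Per' ((cell' c).face i ∘ π) ((cell' c').face i' ∘ π')) →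
      (⟨n, cell⟩ : TropicalTorus.Chain ℝ 8 2).IsCycle Per →
        (⟨n, cell'⟩ : TropicalTorus.Chain ℝ 8 2).IsCycle Per' := by
  sorry

/-- **Stub 3 — period classes of tropical cycles are rational** (homology invariance of the
tautological class for the framed-chain encoding). For a positive definite period matrix `P` and a
framed `2`-chain `Z` of `ℝ⁸ / P ℤ⁸` with vanishing alternating boundary modulo `P ℤ⁸`, the period
coordinates `compound 2 P⁻¹ · Z.classOf` of its tautological class are rational: the class lies in
the image `⋀²(P ℤ⁸) ⊗ ⋀² ℚ⁸` of tropical homology. [cite: MikhalkinZharkov2014Eigenwave, Prop. 4.3]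
[cite: Zharkov2020TropicalWeil, p. 2] -/
theorem stub_cycleClassRational :
    ∀ P : Matrix (Fin 8) (Fin 8) ℝ, P.PosDef → ∀ Z : TropicalTorus.Chain ℝ 8 2, Z.IsCycle P →
      ∃ M : Matrix (TropicalTorus.Sub 8 2) (TropicalTorus.Sub 8 2) ℚ,
        TropicalTorus.compound 2 P⁻¹ * Z.classOf = M.map (algebraMap ℚ ℝ) := by
  sorry

/-! ## Name-keyed aliases of the three statements — the hypotheses of `FormalCycleCriterion_of`
The skeleton audit (`#h21_check_skeleton`) admits a hypothesis of the skeleton theorem only if its head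
constant is a registered obligation or is NAMED like a declared stub; `__Registered.stub_X` is the statement
of `stub_X` verbatim under the stub's short name (device of `Cruxes/AlgebraicDensity/Lines/birth.lean`; the
`__` namespace is an implementation detail, so the audit's stub report resolves each `stub_…` to the sorried
theorem above). `FormalCycleCriterion_of_stubs` checks by definitional unfolding that each alias IS its
stub's statement. -/
namespace __Registered

/-- Statement of `stub_formalFamily`, keyed by the registered stub name. -/
abbrev stub_formalFamily : Prop :=
  ∀ t : Fin 5 → ℝ, t ∈ ksPosCone → LinearIndependent ℚ t →
    ∀ Z : TropicalTorus.Chain ℝ 8 2, Z.IsCycle (ksMatrix t) → Z.Effective →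
      ∃ U : Set (Fin 5 → ℝ), IsOpen U ∧ IsPreconnected U ∧ t ∈ U ∧ U ⊆ ksPosCone ∧
        ∃ cell : (Fin 5 → ℝ) → Fin Z.size → TropicalTorus.Cell ℝ 8 2,
          cell t = Z.cell ∧
          (∀ t' c, (cell t' c).dir = (Z.cell c).dir ∧ (cell t' c).weight = (Z.cell c).weight) ∧
          (∀ t' ∈ U, ∀ (c c' : Fin Z.size) (i i' : Fin 3) (π π' : Equiv.Perm (Fin 2)),
            TropicalTorus.IsTranslate (ksMatrix t) ((Z.cell c).face i ∘ π) ((Z.cell c').face i' ∘ π') →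
              TropicalTorus.IsTranslate (ksMatrix t') ((cell t' c).face i ∘ π) ((cell t' c').face i' ∘ π')) ∧
          (∀ t' ∈ U, (⟨Z.size, cell t'⟩ : TropicalTorus.Chain ℝ 8 2).Effective) ∧
          ContinuousOn (fun t' => TropicalTorus.compound 2 (ksMatrix t')⁻¹ *
            (⟨Z.size, cell t'⟩ : TropicalTorus.Chain ℝ 8 2).classOf) U

/-- Statement of `stub_isCycle_of_incidences`, keyed by the registered stub name. -/
abbrev stub_isCycle_of_incidences : Prop :=
  ∀ (n : ℕ) (cell cell' : Fin n → TropicalTorus.Cell ℝ 8 2) (Per Per' : Matrix (Fin 8) (Fin 8) ℝ),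
    (∀ c, (cell' c).framing = (cell c).framing) →
    (∀ (c c' : Fin n) (i i' : Fin 3) (π π' : Equiv.Perm (Fin 2)),
      TropicalTorus.IsTranslate Per ((cell c).face i ∘ π) ((cell c').face i' ∘ π') →
        TropicalTorus.IsTranslate Per' ((cell' c).face i ∘ π) ((cell' c').face i' ∘ π')) →
    (⟨n, cell⟩ : TropicalTorus.Chain ℝ 8 2).IsCycle Per →
      (⟨n, cell'⟩ : TropicalTorus.Chain ℝ 8 2).IsCycle Per'

/-- Statement of `stub_cycleClassRational`, keyed by the registered stub name. -/
abbrev stub_cycleClassRational : Prop :=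
  ∀ P : Matrix (Fin 8) (Fin 8) ℝ, P.PosDef → ∀ Z : TropicalTorus.Chain ℝ 8 2, Z.IsCycle P →
    ∃ M : Matrix (TropicalTorus.Sub 8 2) (TropicalTorus.Sub 8 2) ℚ,
      TropicalTorus.compound 2 P⁻¹ * Z.classOf = M.map (algebraMap ℚ ℝ)

end __Registered

/-- **Glue lemma (proved).** A continuous rational-valued function on a preconnected set is constant:
two distinct values would enclose an irrational number, attained on the set by the intermediate value
theorem. [folklore] -/
theorem apply_eq_of_ratValued {X : Type*} [TopologicalSpace X] {U : Set X} (hU : IsPreconnected U)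
    {g : X → ℝ} (hg : ContinuousOn g U) (hq : ∀ s ∈ U, ∃ q : ℚ, g s = q) {a b : X}
    (ha : a ∈ U) (hb : b ∈ U) : g a = g b := by
  by_contra hne
  rcases lt_or_gt_of_ne hne with h | h
  · obtain ⟨r, hr, har, hrb⟩ := exists_irrational_btwn h
    obtain ⟨s, hs, hsr⟩ := hU.intermediate_value ha hb hg ⟨har.le, hrb.le⟩
    obtain ⟨q, hsq⟩ := hq s hs
    exact hr.ne_rat q (hsr.symm.trans hsq)
  · obtain ⟨r, hr, hbr, hra⟩ := exists_irrational_btwn h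
    obtain ⟨s, hs, hsr⟩ := hU.intermediate_value hb ha hg ⟨hbr.le, hra.le⟩
    obtain ⟨q, hsq⟩ := hq s hs
    exact hr.ne_rat q (hsr.symm.trans hsq)

/-- **Composition (real proof) — THE SKELETON THEOREM.** Given a `ℚ`-generic `t ∈ ksPosCone` and an
effective tropical `2`-cycle `Z` of `ℝ⁸ / B_t ℤ⁸`: stub 1 gives an open preconnected `U ∋ t` in the
cone and the formal family `⟨Z.size, cell t'⟩` through `Z`; stub 2 makes each member a cycle of
`ℝ⁸ / B_{t'} ℤ⁸`; stub 3 makes its period class rational-valued; continuous and rational-valued on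
the preconnected `U`, the period class is constant, equal to that of `Z = ⟨Z.size, cell t⟩`.
Hypotheses = the three stub statements (name-keyed aliases); concludes the route decl
`FormalCycleCriterion` BY NAME. -/
theorem FormalCycleCriterion_of :
    __Registered.stub_formalFamily → __Registered.stub_isCycle_of_incidences →
      __Registered.stub_cycleClassRational → FormalCycleCriterion := by
  intro h₁ h₂ h₃ t ht hli Z hZc hZe
  obtain ⟨U, hUo, hUc, htU, hUsub, cell, hcellt, hdw, hinc, heff, hcont⟩ := h₁ t ht hli Z hZc hZe
  -- every member of the family is a tropical cycle of its own torus (stub 2)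
  have hcyc : ∀ t' ∈ U, (⟨Z.size, cell t'⟩ : TropicalTorus.Chain ℝ 8 2).IsCycle (ksMatrix t') := by
    intro t' ht'
    refine h₂ Z.size Z.cell (cell t') (ksMatrix t) (ksMatrix t') ?_ (hinc t' ht') hZc
    intro c
    funext K
    simp only [TropicalTorus.Cell.framing, (hdw t' c).1, (hdw t' c).2]
  refine ⟨U, hUo, ⟨t, htU⟩, hUsub, fun t' ht' => ⟨⟨Z.size, cell t'⟩, hcyc t' ht', heff t' ht', ?_⟩⟩
  -- the period class is continuous (stub 1) and rational-valued (stub 3) on the preconnected `U`,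
  -- hence constant there
  have key : ∀ i j,
      (TropicalTorus.compound 2 (ksMatrix t')⁻¹ *
          (⟨Z.size, cell t'⟩ : TropicalTorus.Chain ℝ 8 2).classOf) i j =
        (TropicalTorus.compound 2 (ksMatrix t)⁻¹ *
          (⟨Z.size, cell t⟩ : TropicalTorus.Chain ℝ 8 2).classOf) i j := by
    intro i j
    refine apply_eq_of_ratValued (g := fun s => (TropicalTorus.compound 2 (ksMatrix s)⁻¹ *
      (⟨Z.size, cell s⟩ : TropicalTorus.Chain ℝ 8 2).classOf) i j) hUc ?_ ?_ ht' htU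
    · exact (continuous_apply_apply i j).comp_continuousOn hcont
    · intro s hs
      obtain ⟨M, hM⟩ := h₃ (ksMatrix s) (hUsub hs) _ (hcyc s hs)
      exact ⟨M i j, by rw [hM]; rfl⟩
  have hZ : (⟨Z.size, cell t⟩ : TropicalTorus.Chain ℝ 8 2) = Z := by rw [hcellt]
  exact (Matrix.ext fun i j => key i j).trans (by rw [hZ])

/-- **The crux, closed modulo exactly the three registered stubs** (sanity: the stubs compose, and
each alias is its stub's statement). -/
theorem FormalCycleCriterion_of_stubs : FormalCycleCriterion :=
  FormalCycleCriterion_of stub_formalFamily stub_isCycle_of_incidences stub_cycleClassRational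

end

end Summit.HodgeConjecture.HodgeConjecture.Cruxes.FormalCycleCriterion.Birth
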